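import Summits.RiemannHypothesis.RiemannHypothesis.Theorems.Splittings.RobinFiniteE3Error
import Summits.RiemannHypothesis.RiemannHypothesis.Theorems.Splittings.RobinFiniteE3Large2Window
import HarnessLib

/-!
# RobinFiniteE3Large2 — Part 3/5 — the lifted large branch for `P ≥ 2·10¹⁹`: `gain_caseA6W`, `gain_caseC6W`,
`window_caseC6W`, `G_large2W`.

`RobinFiniteE3Large.G_largeW` gives `S + G ≥ 2.1538/(√P log P)` for every `P ≥ 2·10¹⁰`.  Here, for `2·10¹⁹ ≤ P ≤ B` on the
θ-window: `S + G ≥ c/(√P log P)` for every `c ≤ 2.9` with `c² ≤ 4·0.99925·s(L₁)`,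
`s(L₁) = 1.8018 L₁/(L₁ + 9.6567) + 0.18488 L₁/(L₁ + 15.6481)`, `0 < L₁ ≤ log P` (`G_large2W`) — numerically `c = 2.5422` at
`P = 2·10¹⁹`, `2.5745` at `2·10²²`.  Cases: A `Q ≥ 6√P` (gain alone, `2.9`); B `Q ≤ √P/4` (`RobinFiniteE3Large.window_caseBW`,
`5.8`); C `√P/4 < Q < 6√P` (gain `0.99925·Q/(P log P)` + two-piece window `s(L₁)/(Q log P)`, AM–GM by a completed square).
No new analytic input: the window hypothesis, `thetaP_boundsW`, `window_caseBW` and the `RobinAnalytic` lemmas by name.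

Cell rh-split, seat rh-split-robin-finite g8 (brief sha16 f79c5f09d8bcb036), card `cards/SPLIT-robin-finite.md` §15;
carved from the kernel-checked object `HOME/rh-split-robin-finite/g8/SketchG8-G.lean` (sha16 b720eb98042decc0, rc 0,
0 warnings, 0 sorries, axioms [propext, Classical.choice, Quot.sound]).  Zero `def`, zero `instance`, zero `notation`,
no attribute changes, no `native_decide`.

HONEST LABEL: SPLITTING SEARCH over kernel-typed RH-EQUIVALENCES; a splitting A ∧ B ⟹ RH is CONDITIONAL
bookkeeping unless A and B are both proved; nothing here bears on the truth of RH.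
-/

set_option linter.dupNamespace false

noncomputable section

open Real Filter Finset
open scoped Chebyshev

namespace Summit.RiemannHypothesis.RiemannHypothesis.Theorems.Splittings.RobinFiniteE3

open Literature.NumberTheory.LFunctions Literature.NumberTheory.DiophantineGeometry
open RobinAnalyticSharp

section LargeP2
open RobinAnalytic

/-- Case A (`Q ≥ 6√P`) for `2·10¹⁹ ≤ P ≤ B` on the window: `G ≥ 2.9/(√P log P)`
(`θ(Q) ≥ 0.99947·6√P`, `R ≤ 2.0004 P`, `log R ≤ 1.0157 log P`; `2.9·2.0004·1.0157 ≤ 5.99682`). -/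
theorem gain_caseA6W {B : ℝ} (hW : (∀ y : ℝ, 599 ≤ y → y ≤ B → |θ y - y| ≤ √y * Real.log y ^ 2 / (8 * π))) {P Q : ℕ}
    (hP : (2 * 10 ^ 19 : ℝ) ≤ P) (hPB : (P : ℝ) ≤ B) (hQP : Q ≤ P) (hQ : 6 * √(P : ℝ) ≤ Q) :
    2.9 / (√(P : ℝ) * Real.log P) ≤ θ Q / ((θ P + θ Q) * Real.log (θ P + θ Q)) := by
  have hP10 := P_ge_2e10_of19 hP
  have hL := logP_ge19 hP
  have hsP := sqrtP_ge19 hP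
  have hsq := sq_sqrtP hP10
  have hP0 := P_pos hP10
  obtain ⟨hθP1, hθP2⟩ := thetaP_boundsW hW hP10 hPB
  have hQ30 : (2 : ℝ) ^ 30 ≤ Q := by nlinarith
  have hθQ1 : 0.99947 * Q ≤ θ Q :=
    theta_ge_99947W hW hQ30 ((show (Q : ℝ) ≤ P by exact_mod_cast hQP).trans hPB)
  have hθQP : θ Q ≤ θ P := Chebyshev.theta_mono (by exact_mod_cast hQP)
  set R := θ P + θ Q with hR
  have hR1 : R ≤ 2.0004 * P := by linarith
  have hQnn : (0 : ℝ) ≤ Q := Nat.cast_nonneg Q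
  have hRpos : 1 < R := by nlinarith
  have hlogR0 : 0 < Real.log R := Real.log_pos hRpos
  have hlogR : Real.log R ≤ 1.0157 * Real.log P := by
    have h1 : Real.log R ≤ Real.log (2.0004 * P) := Real.log_le_log (by linarith) hR1
    rw [Real.log_mul (by norm_num) hP0.ne'] at h1
    have h2 : Real.log (2.0004 : ℝ) ≤ 0.6934 := by
      rw [show (2.0004 : ℝ) = 2 * 1.0002 by norm_num, Real.log_mul (by norm_num) (by norm_num)]
      have := Real.log_two_lt_d9
      have := Real.log_le_sub_one_of_pos (show (0 : ℝ) < 1.0002 by norm_num)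
      linarith
    linarith
  rw [div_le_div_iff₀ (by positivity) (by positivity)]
  have hRlogR : R * Real.log R ≤ (2.0004 * P) * (1.0157 * Real.log P) :=
    mul_le_mul hR1 hlogR hlogR0.le (by positivity)
  have hθQ : 5.99682 * √(P : ℝ) ≤ θ Q := by linarith
  calc 2.9 * ((θ P + θ Q) * Real.log (θ P + θ Q)) = 2.9 * (R * Real.log R) := by rw [hR]
    _ ≤ 2.9 * ((2.0004 * P) * (1.0157 * Real.log P)) := by gcongr
    _ = (2.9 * 2.0004 * 1.0157) * (√(P : ℝ) * √(P : ℝ)) * Real.log P := by rw [hsq]; ring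
    _ ≤ 5.99682 * (√(P : ℝ) * √(P : ℝ)) * Real.log P := by gcongr; norm_num
    _ = 5.99682 * √(P : ℝ) * (√(P : ℝ) * Real.log P) := by ring
    _ ≤ θ Q * (√(P : ℝ) * Real.log P) := by gcongr

/-- Case C (gain from `Q`, `√P/4 < Q < 6√P`) for `2·10¹⁹ ≤ P ≤ B` on the window: `G ≥ 0.99925·Q/(P log P)`
(`θ(Q) ≥ 0.99947 Q`, `θ(Q) ≤ 1.00053·6√P ≤ 1.4·10⁻⁹ P`, `R ≤ 1.00021 P`, `log R ≤ 1.0000048 log P`). -/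
theorem gain_caseC6W {B : ℝ} (hW : (∀ y : ℝ, 599 ≤ y → y ≤ B → |θ y - y| ≤ √y * Real.log y ^ 2 / (8 * π))) {P Q : ℕ}
    (hP : (2 * 10 ^ 19 : ℝ) ≤ P) (hPB : (P : ℝ) ≤ B) (hQlo : √(P : ℝ) / 4 < Q) (hQhi : (Q : ℝ) < 6 * √(P : ℝ)) :
    0.99925 * Q / ((P : ℝ) * Real.log P) ≤ θ Q / ((θ P + θ Q) * Real.log (θ P + θ Q)) := by
  have hP10 := P_ge_2e10_of19 hP
  have hL := logP_ge19 hP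
  have hsP := sqrtP_ge19 hP
  have hsq := sq_sqrtP hP10
  have hP0 := P_pos hP10
  obtain ⟨hθP1, hθP2⟩ := thetaP_boundsW hW hP10 hPB
  have hQ30 : (2 : ℝ) ^ 30 ≤ Q := by nlinarith
  have hQ0 : (0 : ℝ) < Q := by linarith
  have hQB : (Q : ℝ) ≤ B := by
    have h6 := mul_le_mul_of_nonneg_right (show (6 : ℝ) ≤ √(P : ℝ) by linarith) (Real.sqrt_nonneg (P : ℝ))
    linarith [hsq]
  have hθQ1 : 0.99947 * Q ≤ θ Q := theta_ge_99947W hW hQ30 hQB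
  have hθQ2 : θ Q ≤ 0.0000000014 * P := by
    have h1 : θ Q ≤ 1.00053 * Q := theta_le_100053W hW hQ30 hQB
    have h3 : √(P : ℝ) * 4472135954 ≤ P :=
      calc √(P : ℝ) * 4472135954 ≤ √(P : ℝ) * √(P : ℝ) :=
            mul_le_mul_of_nonneg_left hsP (Real.sqrt_nonneg _)
        _ = P := hsq
    nlinarith
  set R := θ P + θ Q with hR
  have hR1 : R ≤ 1.00021 * P := by linarith
  have hRpos : 1 < R := by nlinarith
  have hlogR0 : 0 < Real.log R := Real.log_pos hRpos
  have hlogR : Real.log R ≤ 1.0000048 * Real.log P := by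
    have h1 : Real.log R ≤ Real.log (1.00021 * P) := Real.log_le_log (by linarith) hR1
    rw [Real.log_mul (by norm_num) hP0.ne'] at h1
    have h2 := Real.log_le_sub_one_of_pos (show (0 : ℝ) < 1.00021 by norm_num)
    linarith
  rw [div_le_div_iff₀ (by positivity) (by positivity)]
  have hRlogR : R * Real.log R ≤ (1.00021 * P) * (1.0000048 * Real.log P) :=
    mul_le_mul hR1 hlogR hlogR0.le (by positivity)
  calc 0.99925 * Q * ((θ P + θ Q) * Real.log (θ P + θ Q)) = 0.99925 * Q * (R * Real.log R) := by
        rw [hR]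
    _ ≤ 0.99925 * Q * ((1.00021 * P) * (1.0000048 * Real.log P)) := by gcongr
    _ = (0.99925 * 1.00021 * 1.0000048) * Q * (P * Real.log P) := by ring
    _ ≤ 0.99947 * Q * (P * Real.log P) := by gcongr; norm_num
    _ ≤ θ Q * (P * Real.log P) := by gcongr

/-- Case C (two-piece window, `√P/4 < Q < 6√P`) for `2·10¹⁹ ≤ P ≤ B` on the window, with a lower enclosure
`L₁ ≤ log P`: `S ≥ s(L₁)/(Q log P)`, `s(L₁) = 1.8018 L₁/(L₁ + 9.6567) + 0.18488 L₁/(L₁ + 15.6481)`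
(`window_bound2W` at `y = Q`; `log(20Q) ≤ 3 log 5 + log P/2`, `log(400Q) ≤ 4 log 5 + 2 log 2 + log P/2`). -/
theorem window_caseC6W {B : ℝ} (hW : (∀ y : ℝ, 599 ≤ y → y ≤ B → |θ y - y| ≤ √y * Real.log y ^ 2 / (8 * π))) {P Q : ℕ}
    (hP : (2 * 10 ^ 19 : ℝ) ≤ P) (hPB : (P : ℝ) ≤ B) (hQlo : √(P : ℝ) / 4 < Q) (hQhi : (Q : ℝ) < 6 * √(P : ℝ))
    {L₁ : ℝ} (hL₁ : L₁ ≤ Real.log P) (hL₁0 : 0 < L₁) :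
    (1.8018 * L₁ / (L₁ + 9.6567) + 0.18488 * L₁ / (L₁ + 15.6481)) / ((Q : ℝ) * Real.log P) ≤
      ∑ p ∈ (Nat.primesLE P).filter (fun p => Q < p), ((p : ℝ) ^ 2)⁻¹ := by
  have hP10 := P_ge_2e10_of19 hP
  have hL := logP_ge19 hP
  have hsP := sqrtP_ge19 hP
  have hsq := sq_sqrtP hP10
  have hP0 := P_pos hP10
  have hQ30 : (2 : ℝ) ^ 30 ≤ Q := by nlinarith
  have hQ0 : (0 : ℝ) < Q := by linarith
  have hQP : 400 * Q ≤ P := by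
    have : (400 * Q : ℝ) ≤ P := by nlinarith
    exact_mod_cast this
  have hw := window_bound2W hW hQ30 hQP hPB le_rfl
  refine le_trans ?_ hw
  obtain ⟨h5l, h5u⟩ := log_five_bounds
  have h2u := Real.log_two_lt_d9
  have hlog20Q : Real.log (20 * Q) ≤ 4.82832 + Real.log P / 2 := by
    have h1 : Real.log (20 * Q) ≤ Real.log (125 * √(P : ℝ)) :=
      Real.log_le_log (by positivity) (by linarith)
    have h5 : Real.log (125 * √(P : ℝ)) = Real.log 125 + Real.log P / 2 := by
      rw [Real.log_mul (by norm_num) (ne_of_gt (by positivity)), log_sqrtP hP10]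
    have h125 : Real.log (125 : ℝ) = 3 * Real.log 5 := by
      rw [show (125 : ℝ) = 5 ^ 3 by norm_num, Real.log_pow]; push_cast; ring
    linarith
  have hlog400Q : Real.log (400 * Q) ≤ 7.824047 + Real.log P / 2 := by
    have h1 : Real.log (400 * Q) ≤ Real.log (2500 * √(P : ℝ)) :=
      Real.log_le_log (by positivity) (by linarith)
    have h5 : Real.log (2500 * √(P : ℝ)) = Real.log 2500 + Real.log P / 2 := by
      rw [Real.log_mul (by norm_num) (ne_of_gt (by positivity)), log_sqrtP hP10]
    have h2500 : Real.log (2500 : ℝ) = 4 * Real.log 5 + 2 * Real.log 2 := by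
      rw [show (2500 : ℝ) = 5 ^ 4 * 2 ^ 2 by norm_num, Real.log_mul (by norm_num) (by norm_num),
        Real.log_pow, Real.log_pow]
      push_cast; ring
    linarith
  have hlog20Q0 : 0 < Real.log (20 * Q) := Real.log_pos (by linarith)
  have hlog400Q0 : 0 < Real.log (400 * Q) := Real.log_pos (by linarith)
  have hLP : 0 < Real.log P := by linarith
  -- one piece: `a L₁/(L₁ + k) ≤ (a/2) log P / lT` when `lT ≤ k/2 + log P/2` (`L/(L + k)` increasing in `L`)
  have piece : ∀ {a k lT : ℝ}, 0 < a → 0 < k → 0 < lT → lT ≤ k / 2 + Real.log P / 2 →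
      a * L₁ / (L₁ + k) ≤ (a / 2) * Real.log P / lT := by
    intro a k lT ha hk hlT0 hlT
    rw [div_le_div_iff₀ (by linarith) hlT0]
    have h1 : L₁ * lT ≤ (L₁ + k) * Real.log P / 2 := by
      nlinarith [mul_le_mul_of_nonneg_left hlT hL₁0.le, mul_le_mul_of_nonneg_left hL₁ hk.le]
    nlinarith [mul_le_mul_of_nonneg_left h1 ha.le]
  have hp0 := piece (a := 1.8018) (k := 9.6567) (lT := Real.log (20 * Q)) (by norm_num) (by norm_num)
    hlog20Q0 (by linarith)
  have hp1 := piece (a := 0.18488) (k := 15.6481) (lT := Real.log (400 * Q)) (by norm_num) (by norm_num)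
    hlog400Q0 (by linarith)
  have e : (0.9009 / Real.log (20 * Q) + 0.09244 / Real.log (400 * Q)) / (Q : ℝ) =
      ((1.8018 / 2) * Real.log P / Real.log (20 * Q) + (0.18488 / 2) * Real.log P / Real.log (400 * Q)) /
        ((Q : ℝ) * Real.log P) := by
    have hQne : (Q : ℝ) ≠ 0 := hQ0.ne'
    have hLne : Real.log P ≠ 0 := hLP.ne'
    have h20ne : Real.log (20 * Q) ≠ 0 := hlog20Q0.ne'
    have h400ne : Real.log (400 * Q) ≠ 0 := hlog400Q0.ne'
    field_simp
    ring
  rw [e]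
  exact div_le_div_of_nonneg_right (add_le_add hp0 hp1) (by positivity)

/-- **`S + G ≥ c/(√P log P)` for `2·10¹⁹ ≤ P ≤ B`, `Q ≤ P`**, for every `c` with `c ≤ 2.9` (Case A) and
`c² ≤ 4·0.99925·s(L₁)` (Case C, AM–GM of `0.99925·q + s(L₁)/q`, `q = Q/√P`), `L₁ ≤ log P`; Case B (`Q ≤ √P/4`) by
`window_caseBW` (`5.8`). -/
theorem G_large2W {B : ℝ} (hW : (∀ y : ℝ, 599 ≤ y → y ≤ B → |θ y - y| ≤ √y * Real.log y ^ 2 / (8 * π))) {P Q : ℕ}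
    (hP : (2 * 10 ^ 19 : ℝ) ≤ P) (hPB : (P : ℝ) ≤ B) (hQP : Q ≤ P) {L₁ c : ℝ} (hL₁ : L₁ ≤ Real.log P) (hL₁0 : 0 < L₁)
    (hcA : c ≤ 2.9)
    (hcC : c ^ 2 ≤ 4 * 0.99925 * (1.8018 * L₁ / (L₁ + 9.6567) + 0.18488 * L₁ / (L₁ + 15.6481))) :
    c / (√(P : ℝ) * Real.log P) ≤
      ∑ p ∈ (Nat.primesLE P).filter (fun p => Q < p), ((p : ℝ) ^ 2)⁻¹ +
        θ Q / ((θ P + θ Q) * Real.log (θ P + θ Q)) := by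
  have hP10 := P_ge_2e10_of19 hP
  have hL := logP_ge19 hP
  have hsP := sqrtP_ge19 hP
  have hsq := sq_sqrtP hP10
  have hP0 := P_pos hP10
  obtain ⟨hθP1, hθP2⟩ := thetaP_boundsW hW hP10 hPB
  have hden : 0 < √(P : ℝ) * Real.log P := by positivity
  set S := ∑ p ∈ (Nat.primesLE P).filter (fun p => Q < p), ((p : ℝ) ^ 2)⁻¹ with hSdef
  set G := θ Q / ((θ P + θ Q) * Real.log (θ P + θ Q)) with hGdef
  have hS0 : 0 ≤ S := Finset.sum_nonneg fun p _ => by positivity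
  have hG0 : 0 ≤ G := by
    have h1 : 0 ≤ θ Q := Chebyshev.theta_nonneg _
    have h2 : 1 < θ P + θ Q := by nlinarith
    have h3 : 0 < Real.log (θ P + θ Q) := Real.log_pos h2
    positivity
  have hcB : c ≤ 5.8 := by linarith
  rcases le_or_gt (6 * √(P : ℝ)) Q with hA | hA
  · -- Case A
    have := gain_caseA6W hW hP hPB hQP hA
    have h2 : c / (√(P : ℝ) * Real.log P) ≤ 2.9 / (√(P : ℝ) * Real.log P) :=
      div_le_div_of_nonneg_right hcA hden.le
    linarith
  rcases le_or_gt (Q : ℝ) (√(P : ℝ) / 4) with hB | hB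
  · -- Case B
    have := window_caseBW hW hP10 hPB hB
    have h2 : c / (√(P : ℝ) * Real.log P) ≤ 5.8 / (√(P : ℝ) * Real.log P) :=
      div_le_div_of_nonneg_right hcB hden.le
    linarith
  · -- Case C
    have h1 := gain_caseC6W hW hP hPB hB hA
    have h2 := window_caseC6W hW hP hPB hB hA hL₁ hL₁0
    set s := 1.8018 * L₁ / (L₁ + 9.6567) + 0.18488 * L₁ / (L₁ + 15.6481) with hs
    have hs0 : 0 ≤ s := by positivity
    have hQ0 : (0 : ℝ) < Q := by
      have : (0 : ℝ) < √(P : ℝ) / 4 := by positivity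
      linarith
    have hLpos : 0 < Real.log P := by linarith
    have hr0 : 0 < √(P : ℝ) := by linarith
    -- the quadratic form `0.99925 Q² − c Q √P + s √P² ≥ 0` from `c² ≤ 4·0.99925·s`
    have hquad : 0 ≤ 0.99925 * (Q : ℝ) ^ 2 - c * Q * √(P : ℝ) + s * √(P : ℝ) ^ 2 := by
      have e : 0.99925 * (Q : ℝ) ^ 2 - c * Q * √(P : ℝ) + s * √(P : ℝ) ^ 2 =
          0.99925 * ((Q : ℝ) - c / (2 * 0.99925) * √(P : ℝ)) ^ 2 +
            (s - c ^ 2 / (4 * 0.99925)) * √(P : ℝ) ^ 2 := by ring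
      rw [e]
      have h4 : 0 ≤ s - c ^ 2 / (4 * 0.99925) := by
        rw [sub_nonneg, div_le_iff₀ (by norm_num)]; linarith
      positivity
    have hid : (0.99925 * (Q : ℝ) ^ 2 + s * P) * √(P : ℝ) - c * P * Q =
        √(P : ℝ) * (0.99925 * (Q : ℝ) ^ 2 - c * Q * √(P : ℝ) + s * √(P : ℝ) ^ 2) := by
      linear_combination (c * (Q : ℝ) - s * √(P : ℝ)) * hsq
    have hnum : c * (P : ℝ) * Q ≤ (0.99925 * (Q : ℝ) ^ 2 + s * P) * √(P : ℝ) := by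
      nlinarith [mul_nonneg hr0.le hquad]
    have key : c / (√(P : ℝ) * Real.log P) ≤
        0.99925 * Q / ((P : ℝ) * Real.log P) + s / ((Q : ℝ) * Real.log P) := by
      have e1 : 0.99925 * Q / ((P : ℝ) * Real.log P) + s / ((Q : ℝ) * Real.log P) =
          (0.99925 * (Q : ℝ) ^ 2 + s * P) / ((P : ℝ) * Q * Real.log P) := by
        have hQne : (Q : ℝ) ≠ 0 := hQ0.ne'
        have hLne : Real.log P ≠ 0 := hLpos.ne'
        have hPne : (P : ℝ) ≠ 0 := hP0.ne'
        field_simp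
      rw [e1, div_le_div_iff₀ (by positivity) (by positivity)]
      nlinarith [mul_le_mul_of_nonneg_right hnum hLpos.le]
    linarith

end LargeP2

end Summit.RiemannHypothesis.RiemannHypothesis.Theorems.Splittings.RobinFiniteE3
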